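import Summits.HubbardSuperconductivity.HubbardSuperconductivity.Theorems.ParentFirstSMADiluteDWavePairsCondenseNormalForm
import Summits.HubbardSuperconductivity.HubbardSuperconductivity.Theorems.ParentFirstSMADiluteDWavePairsCondenseDichotomy
import HarnessLib

/-!
# STRATEGY CENSUS (companion sketch) — crux `DiluteDWavePairsCondense` (stmt-HubbardSuperconductivity-10771)

Crux-strategist `cstrat-stmt-HubbardSuperconductivity-10771-s1`, 2026-08-17. Route `ParentFirstSMA` (rev 2), crux of
rank 4. This file is the TYPED half of `STRATEGY-CENSUS.md` (same crux directory): every named object below is a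
normal form, a strengthening, a decomposition piece or a negation target discussed there. It settles nothing about the
crux; it contains no `sorry`; the unproved objects are `def … : Prop` only.

Contents
* §0  normal form `crux_iff_nf` (= landed p147117 over named hypotheses `HA/HB/HC` and `EveryGSOrder`), negation
      normal form `not_crux_iff`, the pointwise reading `summit_of_crux_of_package` / `crux_iff_not_bcdp_or_window`
      (with the landed dichotomy p151329).
* §S  strengthening `UniformLinearFloor` (S⁺1) and its trivial discharge to the crux.
* §D  decomposition D2 `ExistsGSOrder ∧ Homogeneous ↔ EveryGSOrder` (an EQUIVALENCE split: both pieces are implied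
      by the conclusion; the ∃-piece keeps the whole condensation content).
* §N  negation target `ZeroOrderGS` (a dark ground state along infinitely many even sides), its discharge
      `not_everyGSOrder_of_zeroOrderGS`, the refutation shape `not_crux_of_darkWitness`, and the TYPED (unproved)
      singlet-blindness lemma `SingletBlindMaxSpin` behind attempt N1.

References: see `STRATEGY-CENSUS.md` §7.
-/

set_option linter.dupNamespace false

noncomputable section

namespace Summit.HubbardSuperconductivity.HubbardSuperconductivity.Cruxes.DiluteDWavePairsCondense.Census

open Matrix Finset Filter
open Literature.Probability.LatticeModels Literature.MathematicalPhysics.QuantumLattice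
open Summit.HubbardSuperconductivity.HubbardSuperconductivity.Theses.ParentFirstSMA
open Summit.HubbardSuperconductivity.HubbardSuperconductivity.Theorems.ParentFirstSMA
open Summit.HubbardSuperconductivity.TwTipContinuation.Negative (summitMatrix_of_everyGSOrder
  everyGSOrder_of_summitMatrix expect_pairIntensity_le)
open scoped ComplexOrder

/-! ## §0 Normal forms -/

/-- Hypothesis (a): uniform charge gap of the half-filled parent along even sides. [folklore] -/
def HA (U : ℝ) : Prop :=
  ∃ g : ℝ, 0 < g ∧ ∃ L₀ : ℕ, ∀ L : ℕ, L₀ ≤ L → Even L → g ≤ chargeGap (fermionTorusGraph 2 L) 1 U (L ^ 2)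

/-- Hypothesis (b): uniform two-hole binding. [folklore] -/
def HB (U : ℝ) : Prop :=
  ∃ b : ℝ, 0 < b ∧ ∃ L₀ : ℕ, ∀ L : ℕ, L₀ ≤ L → Even L →
    b ≤ 2 * groundEnergyAt (fermionTorusGraph 2 L) 1 U (L ^ 2 - 1) - groundEnergyAt (fermionTorusGraph 2 L) 1 U (L ^ 2)
      - groundEnergyAt (fermionTorusGraph 2 L) 1 U (L ^ 2 - 2)

/-- Hypothesis (c): `d_{x²-y²}`-coherence of the bound pair. [folklore] -/
def HC (U : ℝ) : Prop :=
  ∃ z : ℝ, 0 < z ∧ ∃ L₀ : ℕ, ∀ (L : ℕ) [NeZero L], L₀ ≤ L → Even L →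
    ∃ φ₂ ψ₀ : Fock (Orb (FermionTorus 2 L)), IsGroundState (hubbardTorus 2 L 1 U) (L ^ 2 - 2) φ₂ ∧ star φ₂ ⬝ᵥ φ₂ = 1 ∧
      IsGroundState (hubbardTorus 2 L 1 U) (L ^ 2) ψ₀ ∧ star ψ₀ ⬝ᵥ ψ₀ = 1 ∧
      z * (L : ℝ) ^ 2 ≤ ‖star φ₂ ⬝ᵥ (pairField dWaveFormFactor L *ᵥ ψ₀)‖ ^ 2

/-- The every-ground-state order floor at `(U, δ)` (the summit's matrix in normal form, p147117 /
`summitMatrix_iff_everyGSOrder`). [cite: Scalapino1995, §2 eq. (2.4)] -/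
def EveryGSOrder (U δ : ℝ) : Prop :=
  ∃ c : ℝ, 0 < c ∧ ∃ L₀ : ℕ, ∀ (L : ℕ) [NeZero L], L₀ ≤ L → Even L →
    ∀ ψ : Fock (Orb (FermionTorus 2 L)), star ψ ⬝ᵥ ψ = 1 →
      IsGroundStateInSector (hubbardTorus 2 L 1 U) (2 * ⌊(1 - δ) * (L : ℝ) ^ 2 / 2⌋₊) 0 ψ →
        c * (L : ℝ) ^ 4 ≤ (expect ((pairField dWaveFormFactor L)ᴴ * pairField dWaveFormFactor L) ψ).re

/-- The crux in normal form. [folklore] -/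
def CruxNF : Prop :=
  ∀ U : ℝ, 12 ≤ U → U ≤ 24 → HA U → HB U → HC U → ∃ δ ∈ Set.Ioo (0 : ℝ) (1 / 2), EveryGSOrder U δ

/-- `DiluteDWavePairsCondense ↔ CruxNF` — the landed normal form p147117, names inserted. [folklore] -/
theorem crux_iff_nf : DiluteDWavePairsCondense ↔ CruxNF :=
  diluteDWavePairsCondense_iff_everyGSOrder

/-- Negation normal form: ONE `U` of the window where the few-hole package (a)∧(b)∧(c) holds and the pure
torus is dark at EVERY doping refutes the crux — and nothing less does. [folklore] -/
theorem not_crux_iff :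
    ¬ DiluteDWavePairsCondense ↔
      ∃ U : ℝ, 12 ≤ U ∧ U ≤ 24 ∧ HA U ∧ HB U ∧ HC U ∧ ∀ δ ∈ Set.Ioo (0 : ℝ) (1 / 2), ¬ EveryGSOrder U δ := by
  rw [crux_iff_nf]
  unfold CruxNF
  push Not
  exact Iff.rfl

/-- Crux #3 of the route is literally "the (b)∧(c) package at some `U` of the window". [folklore] -/
theorem bcdp_iff : BoundCoherentDWavePairs ↔ ∃ U : ℝ, 12 ≤ U ∧ U ≤ 24 ∧ HB U ∧ HC U := Iff.rfl

/-- Pointwise reading: AT a `U` where the package holds, the crux IS the summit's matrix there, hence the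
summit (this is `closes` with (a) fed directly instead of via crux #2 + `MottGapFromSingleMode`). [folklore] -/
theorem summit_of_crux_of_package (h : DiluteDWavePairsCondense) {U : ℝ} (h12 : 12 ≤ U) (h24 : U ≤ 24)
    (ha : HA U) (hb : HB U) (hc : HC U) : HubbardSuperconductivity := by
  obtain ⟨δ, hδ, hE⟩ := (crux_iff_nf.1 h) U h12 h24 ha hb hc
  exact ⟨U, by linarith, δ, hδ, summitMatrix_of_everyGSOrder hE⟩

/-- … and where the package fails the crux holds vacuously; globally `¬#3 → #4` (landed p151329). [folklore] -/
theorem crux_of_not_bcdp (h : ¬ BoundCoherentDWavePairs) : DiluteDWavePairsCondense :=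
  diluteDWavePairsCondense_of_not_boundCoherentDWavePairs h

/-- The crux's truth value, pointwise: `¬package(U) ∨ ∃ δ, EveryGSOrder U δ` for every `U ∈ [12,24]`. [folklore] -/
theorem crux_iff_pointwise :
    DiluteDWavePairsCondense ↔
      ∀ U : ℝ, 12 ≤ U → U ≤ 24 → ¬ (HA U ∧ HB U ∧ HC U) ∨ ∃ δ ∈ Set.Ioo (0 : ℝ) (1 / 2), EveryGSOrder U δ := by
  rw [crux_iff_nf]
  constructor
  · intro h U h12 h24
    by_cases hp : HA U ∧ HB U ∧ HC U
    · exact Or.inr (h U h12 h24 hp.1 hp.2.1 hp.2.2)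
    · exact Or.inl hp
  · intro h U h12 h24 ha hb hc
    rcases h U h12 h24 with hn | hy
    · exact absurd ⟨ha, hb, hc⟩ hn
    · exact hy

/-! ## §S Strengthen -/

/-- **S⁺1 (uniform linear floor):** on a doping window `(0, δ₀]` the every-GS order is at least `κ·δ·L⁴`
with ONE `κ` (the Randeria–Duan–Shieh / dilute-BEC prediction `L⁻⁴⟨Δ_d†Δ_d⟩ ≈ z · (pair density)` made
uniform; Randeria–Duan–Shieh, PRL 62 (1989) 981, doi:10.1103/PhysRevLett.62.981). [folklore] -/
def UniformLinearFloor (U : ℝ) : Prop :=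
  ∃ δ₀ κ : ℝ, 0 < δ₀ ∧ δ₀ < 1 / 2 ∧ 0 < κ ∧ ∀ δ : ℝ, 0 < δ → δ ≤ δ₀ → ∃ L₀ : ℕ, ∀ (L : ℕ) [NeZero L], L₀ ≤ L → Even L →
    ∀ ψ : Fock (Orb (FermionTorus 2 L)), star ψ ⬝ᵥ ψ = 1 →
      IsGroundStateInSector (hubbardTorus 2 L 1 U) (2 * ⌊(1 - δ) * (L : ℝ) ^ 2 / 2⌋₊) 0 ψ →
        κ * δ * (L : ℝ) ^ 4 ≤ (expect ((pairField dWaveFormFactor L)ᴴ * pairField dWaveFormFactor L) ψ).re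

/-- S⁺1 gives the every-GS order at EVERY doping of its window (so it is strictly more than the crux needs). [folklore] -/
theorem everyGSOrder_of_uniformLinearFloor {U : ℝ} (h : UniformLinearFloor U) :
    ∃ δ₀ : ℝ, 0 < δ₀ ∧ δ₀ < 1 / 2 ∧ ∀ δ : ℝ, 0 < δ → δ ≤ δ₀ → EveryGSOrder U δ := by
  obtain ⟨δ₀, κ, hδ₀, hδ₀', hκ, h⟩ := h
  refine ⟨δ₀, hδ₀, hδ₀', fun δ hδ hδ' => ?_⟩
  obtain ⟨L₀, hL⟩ := h δ hδ hδ'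
  exact ⟨κ * δ, mul_pos hκ hδ, L₀, fun L _ hL₀ hE ψ hψ hgs => hL L hL₀ hE ψ hψ hgs⟩

/-- Discharge: S⁺1 on the window (under the package) proves the crux — the added rigidity is never USED. [folklore] -/
theorem crux_of_uniformLinearFloor
    (h : ∀ U : ℝ, 12 ≤ U → U ≤ 24 → HA U → HB U → HC U → UniformLinearFloor U) : DiluteDWavePairsCondense := by
  rw [crux_iff_nf]
  intro U h12 h24 ha hb hc
  obtain ⟨δ₀, hδ₀, hδ₀', hall⟩ := everyGSOrder_of_uniformLinearFloor (h U h12 h24 ha hb hc)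
  exact ⟨δ₀, ⟨hδ₀, hδ₀'⟩, hall δ₀ hδ₀ le_rfl⟩

/-! ## §D Decomposition D2: `∃`-ground-state order × ground-eigenspace homogeneity -/

/-- D2, piece 1: SOME normalised sector ground state carries the order floor, eventually in even `L`. [folklore] -/
def ExistsGSOrder (U δ : ℝ) : Prop :=
  ∃ c : ℝ, 0 < c ∧ ∃ L₀ : ℕ, ∀ (L : ℕ) [NeZero L], L₀ ≤ L → Even L →
    ∃ ψ : Fock (Orb (FermionTorus 2 L)), star ψ ⬝ᵥ ψ = 1 ∧
      IsGroundStateInSector (hubbardTorus 2 L 1 U) (2 * ⌊(1 - δ) * (L : ℝ) ^ 2 / 2⌋₊) 0 ψ ∧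
        c * (L : ℝ) ^ 4 ≤ (expect ((pairField dWaveFormFactor L)ᴴ * pairField dWaveFormFactor L) ψ).re

/-- D2, piece 2 (the `AverageToEvery` / `GroundEigenspaceHomogeneity` shape at fixed `(U,δ)`): any two
normalised sector ground states have comparable order, `(1-θ)·order(ψ') ≤ order(ψ)`, `θ < 1`. [folklore] -/
def Homogeneous (U δ : ℝ) : Prop :=
  ∃ θ : ℝ, θ < 1 ∧ ∃ L₀ : ℕ, ∀ (L : ℕ) [NeZero L], L₀ ≤ L → Even L →
    ∀ ψ ψ' : Fock (Orb (FermionTorus 2 L)), star ψ ⬝ᵥ ψ = 1 → star ψ' ⬝ᵥ ψ' = 1 →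
      IsGroundStateInSector (hubbardTorus 2 L 1 U) (2 * ⌊(1 - δ) * (L : ℝ) ^ 2 / 2⌋₊) 0 ψ →
      IsGroundStateInSector (hubbardTorus 2 L 1 U) (2 * ⌊(1 - δ) * (L : ℝ) ^ 2 / 2⌋₊) 0 ψ' →
        (1 - θ) * (expect ((pairField dWaveFormFactor L)ᴴ * pairField dWaveFormFactor L) ψ').re ≤
          (expect ((pairField dWaveFormFactor L)ᴴ * pairField dWaveFormFactor L) ψ).re

/-- D2 glue (sorry-free): `ExistsGSOrder → Homogeneous → EveryGSOrder`. [folklore] -/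
theorem everyGSOrder_of_exists_of_homogeneous {U δ : ℝ} (h₁ : ExistsGSOrder U δ) (h₂ : Homogeneous U δ) :
    EveryGSOrder U δ := by
  obtain ⟨c, hc, L₁, h₁⟩ := h₁
  obtain ⟨θ, hθ, L₂, h₂⟩ := h₂
  refine ⟨(1 - θ) * c, mul_pos (by linarith) hc, max L₁ L₂, fun L _ hL hE ψ hψ hgs => ?_⟩
  obtain ⟨ψ', hψ', hgs', hord'⟩ := h₁ L (le_of_max_le_left hL) hE
  have hcmp := h₂ L (le_of_max_le_right hL) hE ψ ψ' hψ hψ' hgs hgs'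
  calc (1 - θ) * c * (L : ℝ) ^ 4 = (1 - θ) * (c * (L : ℝ) ^ 4) := by ring
    _ ≤ (1 - θ) * (expect ((pairField dWaveFormFactor L)ᴴ * pairField dWaveFormFactor L) ψ').re :=
        mul_le_mul_of_nonneg_left hord' (by linarith)
    _ ≤ _ := hcmp

/-- D2 necessity (i): the conclusion implies the `∃`-piece (sector ground states exist, landed
`NoGo.exists_unit_groundStateInSector_hubbardTorus`). [folklore] -/
theorem existsGSOrder_of_everyGSOrder {U δ : ℝ} (hδ : -1 ≤ δ) (h : EveryGSOrder U δ) : ExistsGSOrder U δ := by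
  obtain ⟨c, hc, L₀, hL⟩ := h
  refine ⟨c, hc, L₀, fun L _ hL₀ hE => ?_⟩
  obtain ⟨ψ, hψ, hgs⟩ :=
    Summit.HubbardSuperconductivity.NoGo.exists_unit_groundStateInSector_hubbardTorus L 1 U
      (Summit.HubbardSuperconductivity.NoGo.floor_pairNumber_le δ hδ L)
  exact ⟨ψ, hψ, hgs, hL L hL₀ hE ψ hψ hgs⟩

/-- D2 necessity (ii): the conclusion implies the homogeneity piece too, through the a-priori ceiling
`order ≤ C·L⁴` (`expect_pairIntensity_le`). Hence D2 is an EQUIVALENCE split. [folklore] -/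
theorem homogeneous_of_everyGSOrder {U δ : ℝ} (h : EveryGSOrder U δ) : Homogeneous U δ := by
  obtain ⟨c, hc, L₀, hL⟩ := h
  -- the universal ceiling constant of `expect_pairIntensity_le`
  set C : ℝ := (∑ e ∈ insert 0 unitSteps, ‖((dWaveFormFactor e / Real.sqrt 2 : ℝ) : ℂ)‖ * 2) ^ 2 with hCdef
  have hC0 : 0 ≤ C := by positivity
  -- choose θ with (1-θ)·C ≤ c, e.g. 1-θ = c/(C+c)
  refine ⟨1 - c / (C + c), by
      have : 0 < c / (C + c) := div_pos hc (by linarith)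
      linarith, L₀, fun L _ hL₀ hE ψ ψ' hψ hψ' hgs hgs' => ?_⟩
  have hceil : (expect ((pairField dWaveFormFactor L)ᴴ * pairField dWaveFormFactor L) ψ').re ≤ C * (L : ℝ) ^ 4 := by
    rw [hCdef]; exact expect_pairIntensity_le L ψ' hψ'
  have hfloor := hL L hL₀ hE ψ hψ hgs
  have hL4 : (0 : ℝ) ≤ (L : ℝ) ^ 4 := by positivity
  have hfrac : 0 ≤ c / (C + c) := div_nonneg hc.le (by linarith)
  have key : c / (C + c) * (C * (L : ℝ) ^ 4) ≤ c * (L : ℝ) ^ 4 := by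
    have hCc : 0 < C + c := by linarith
    rw [div_mul_eq_mul_div, div_le_iff₀ hCc]
    nlinarith [mul_nonneg hc.le hL4, mul_nonneg hC0 hL4]
  calc (1 - (1 - c / (C + c))) * (expect ((pairField dWaveFormFactor L)ᴴ * pairField dWaveFormFactor L) ψ').re
        = c / (C + c) * (expect ((pairField dWaveFormFactor L)ᴴ * pairField dWaveFormFactor L) ψ').re := by ring
    _ ≤ c / (C + c) * (C * (L : ℝ) ^ 4) := mul_le_mul_of_nonneg_left hceil hfrac
    _ ≤ c * (L : ℝ) ^ 4 := key
    _ ≤ _ := hfloor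

/-- D2 is an equivalence split of the conclusion (for admissible `δ`). [folklore] -/
theorem everyGSOrder_iff_exists_and_homogeneous {U δ : ℝ} (hδ : -1 ≤ δ) :
    EveryGSOrder U δ ↔ ExistsGSOrder U δ ∧ Homogeneous U δ :=
  ⟨fun h => ⟨existsGSOrder_of_everyGSOrder hδ h, homogeneous_of_everyGSOrder h⟩,
    fun h => everyGSOrder_of_exists_of_homogeneous h.1 h.2⟩

/-- D2 as a typed split of the CRUX (glue proved): `Sub₁ = package ⇒ ∃δ ∃-GS order`, `Sub₂ = homogeneity there`. [folklore] -/
theorem crux_of_D2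
    (sub₁ : ∀ U : ℝ, 12 ≤ U → U ≤ 24 → HA U → HB U → HC U → ∃ δ ∈ Set.Ioo (0 : ℝ) (1 / 2), ExistsGSOrder U δ ∧ Homogeneous U δ) :
    DiluteDWavePairsCondense := by
  rw [crux_iff_nf]
  intro U h12 h24 ha hb hc
  obtain ⟨δ, hδ, h₁, h₂⟩ := sub₁ U h12 h24 ha hb hc
  exact ⟨δ, hδ, everyGSOrder_of_exists_of_homogeneous h₁ h₂⟩

/-! ## §N Negation -/

/-- **Negation target (attempt N1/N4 shape):** along infinitely many even sides some normalised sector ground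
state is DARK — annihilated by the `d`-wave pair field outright. [folklore] -/
def ZeroOrderGS (U δ : ℝ) : Prop :=
  ∀ L₀ : ℕ, ∃ L : ℕ, ∃ _ : NeZero L, L₀ ≤ L ∧ Even L ∧
    ∃ ψ : Fock (Orb (FermionTorus 2 L)), star ψ ⬝ᵥ ψ = 1 ∧
      IsGroundStateInSector (hubbardTorus 2 L 1 U) (2 * ⌊(1 - δ) * (L : ℝ) ^ 2 / 2⌋₊) 0 ψ ∧
        pairField dWaveFormFactor L *ᵥ ψ = 0

/-- A dark ground state has order `0`. [folklore] -/
theorem order_eq_zero_of_dark {L : ℕ} [NeZero L] {ψ : Fock (Orb (FermionTorus 2 L))}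
    (h : pairField dWaveFormFactor L *ᵥ ψ = 0) :
    (expect ((pairField dWaveFormFactor L)ᴴ * pairField dWaveFormFactor L) ψ).re = 0 := by
  rw [PosSemidefTrace.expect_conjTranspose_mul, h]
  simp

/-- Discharge: dark ground states along infinitely many even sides kill the every-GS order floor. [folklore] -/
theorem not_everyGSOrder_of_zeroOrderGS {U δ : ℝ} (h : ZeroOrderGS U δ) : ¬ EveryGSOrder U δ := by
  rintro ⟨c, hc, L₀, hL⟩
  obtain ⟨L, inst, hL₀, hE, ψ, hψ, hgs, hdark⟩ := h (max L₀ 1)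
  have hb := hL L (le_of_max_le_left hL₀) hE ψ hψ hgs
  rw [order_eq_zero_of_dark hdark] at hb
  have hL1 : (1 : ℝ) ≤ (L : ℝ) := by exact_mod_cast (le_of_max_le_right hL₀)
  have : 0 < c * (L : ℝ) ^ 4 := by positivity
  linarith

/-- **What a refutation of the crux needs (shape):** the few-hole package PROVED at one `U ∈ [12,24]` AND a dark
ground state along infinitely many even sides at EVERY doping `δ ∈ (0,1/2)` there. [folklore] -/
theorem not_crux_of_darkWitness
    (h : ∃ U : ℝ, 12 ≤ U ∧ U ≤ 24 ∧ HA U ∧ HB U ∧ HC U ∧ ∀ δ ∈ Set.Ioo (0 : ℝ) (1 / 2), ZeroOrderGS U δ) :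
    ¬ DiluteDWavePairsCondense := by
  rw [not_crux_iff]
  obtain ⟨U, h12, h24, ha, hb, hc, hd⟩ := h
  exact ⟨U, h12, h24, ha, hb, hc, fun δ hδ => not_everyGSOrder_of_zeroOrderGS (hd δ hδ)⟩

/-- **Singlet blindness of maximal-spin vectors (attempt N1; TYPED, not proved here).** A singlet pair field
(`[S², Δ_d] = 0`) lowers `N` by two without changing total spin, so it ANNIHILATES every `N`-particle vector of
maximal total spin `S = N/2` (eigenvalue `(N/2)(N/2+1)` of the Casimir `spinSq`): the image would be an
`(N-2)`-particle vector of spin `N/2 > (N-2)/2`. Under saturated (Nagaoka) ferromagnetism of a sector floor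
this produces `ZeroOrderGS`; the premise is excluded on the window by the variational instability of the
Nagaoka state for `U < 77.7 t` at every hole density (Wurth–Uhrig–Müller-Hartmann 1996), so the lemma feeds no
line here (Wurth–Uhrig–Müller-Hartmann, Ann. Phys. 508 (1996) 148, arXiv:cond-mat/9512060, abstract and §5). [folklore] -/
def SingletBlindMaxSpin : Prop :=
  ∀ (L N : ℕ) [NeZero L] (ψ : Fock (Orb (FermionTorus 2 L))), IsNParticle N ψ →
    (spinSq : Matrix (Finset (Orb (FermionTorus 2 L))) _ ℂ) *ᵥ ψ = (((N : ℝ) / 2 * ((N : ℝ) / 2 + 1) : ℝ) : ℂ) • ψ →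
      pairField dWaveFormFactor L *ᵥ ψ = 0

/-- **Saturated sector floor (the physical premise of N1; TYPED, expected FALSE on the window).** [folklore] -/
def SaturatedFloor (U δ : ℝ) : Prop :=
  ∀ L₀ : ℕ, ∃ L : ℕ, ∃ _ : NeZero L, L₀ ≤ L ∧ Even L ∧
    ∃ ψ : Fock (Orb (FermionTorus 2 L)), star ψ ⬝ᵥ ψ = 1 ∧
      IsGroundStateInSector (hubbardTorus 2 L 1 U) (2 * ⌊(1 - δ) * (L : ℝ) ^ 2 / 2⌋₊) 0 ψ ∧
        (spinSq : Matrix (Finset (Orb (FermionTorus 2 L))) _ ℂ) *ᵥ ψ =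
          ((((2 * ⌊(1 - δ) * (L : ℝ) ^ 2 / 2⌋₊ : ℕ) : ℝ) / 2 * ((((2 * ⌊(1 - δ) * (L : ℝ) ^ 2 / 2⌋₊ : ℕ) : ℝ)) / 2 + 1) : ℝ) : ℂ) • ψ

/-- N1 assembled: singlet blindness + a saturated floor give the dark witness at `(U,δ)`. [folklore] -/
theorem zeroOrderGS_of_saturated (hS : SingletBlindMaxSpin) {U δ : ℝ} (h : SaturatedFloor U δ) : ZeroOrderGS U δ := by
  intro L₀
  obtain ⟨L, inst, hL₀, hE, ψ, hψ, hgs, hspin⟩ := h L₀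
  refine ⟨L, inst, hL₀, hE, ψ, hψ, hgs, ?_⟩
  have hN : IsNParticle (2 * ⌊(1 - δ) * (L : ℝ) ^ 2 / 2⌋₊) ψ := ((mem_szSector_iff _ _ _).1 hgs.1).1
  exact hS L _ ψ hN hspin

end Summit.HubbardSuperconductivity.HubbardSuperconductivity.Cruxes.DiluteDWavePairsCondense.Census

end
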